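import Summits.QuantumFields.YangMills.Theorems.BalabanUVNodesN15KingModelFullPropagatorProfile
import Literature.MathematicalPhysics.QuantumFieldTheory.King1986.SliceSum

/-!
# BalabanUVNodes ∕ N15 — THE KING-MODEL RUNG, CURVED EDITION (PART R-b): THE POWER LAW OF THE FULL `A = 0` FLUCTUATION PROPAGATOR —
# `|G^η_K(x, y)| ≤ C·(L^K∕r(x, y))^{d−1}` for `x ≠ y` (= `C|x − y|^{2−(d+1)}` in unit coordinates) and the diagonal order `(L^K)^{d−1}`,
# UNIFORMLY in `K`, the volume and the mass: part R-a's level profile read through the tree's `King1986.sliceSum_le`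
# (Track A, DAG node N15 = NE2; FAN-OUT v1.1 §N15 s3 «KING-MODEL RUNG … + the one-line statement of what the curved case adds»)

HONEST FRAMING.  Count-neutral kernel bookkeeping (cell `pub-ymgap`, seat `pub-ymgap-dag-n15-e` g8; `--supports stmt-QuantumFields-20296
--as helper` = K3⁵ `SpineGivenEndpointR13SepCoP`, WORDS-141).  TEMPLATE LITERATURE, `A = 0`: C. King's scalar U(1)-Higgs MODEL on finite tori ([King1986]
§2.2 p. 653 (2.13)–(2.17), p. 654 (2.20), Theorem 3.3 pp. 655–656 ((3.7) p. 656), Prop. 3.7 (3.63) p. 663 «`|G^η_{(j)}(x, y)|, |∂^η_μG^η_{(j)}(x, y)| ≤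
C{(L^jη)^{2−d}, (L^jη)^{1−d}}·exp[−δ₀(L^jη)^{−1}|x − y|]`», King's `d` = this file's `d + 1`), NOT Bałaban's covariant objects; the power law
below is the (2.17)-SUMMED SHAPE of (3.63) for King's (2.13) at `A = 0` (Theorem 3.3 ∕ [Ba 4]-type kernel singularity), NOT a printed
proposition; NE2⁺ is NOT PRINTED and not proved here; NOT a node discharge; nothing continuum ∕ ℝ⁴ ∕ OS ∕ mass-gap ∕ Clay.  0 `sorry`, 0 `def`,
standard axioms.

THE POINT.  Part R-a (`…N15KingModelFullPropagatorProfile`, `fullProp_profile_unif`) proved, for King's full `A = 0` fluctuation propagator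
`G(K, M, m²) = constrainedProp (L^K) M (aK a L K) ((L^K)²) m²` and ALL fine pairs, `|G(K, M, m²)(x, y)| ≤ C·Σ_{i<K} Λ^i·e^{−δ·r·L^i∕L^K}`
(`Λ = L^{d+1}∕L²`, `r` = fine torus distance).  THIS FILE turns the level sum into closed forms:
* §1 `levelTerm_eq`, **`levelSum_le_powerLaw`** — the level sum IS King's slice sum: `Σ_{i<K}(L^p)^i e^{−δrL^i∕L^K} ≤ (K_p(δ∕L)∕L^p)·(L^K∕r)^p`
  for `r ≥ 1`, `p ≥ 1`, `K_p(δ) = 2(p+1)!∕δ^{p+1} + 2` (`Finset.sum_range_reflect` + `King1986.sliceSum_le` at `η = (L^K)⁻¹`, rate `δ∕L` — the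
  tree's bookkeeping «(3.63) per slice ⇒ power law» (`Lit/King1986/SliceSum`), which names this implication and the (W1) profile in its
  header but had no `A = 0` OBJECT to act on); `levelSum_le_geom` (`Σ_{i<K}Λ^i w_i ≤ Λ^K` for `Λ ≥ 2`, `w_i ≤ 1`); `Lam_eq_pow` (`Λ = L^{d−1}`);
* §2 ★★ **`fullProp_powerLaw_unif`** (`2 ≤ d`, i.e. King's `d ≥ 3`): `∃ C > 0 ∀ K ≥ 1 ∀ N = L^K ∀ cube 2L^e ∀ 0 < m² ≤ m₀² ∀ x ≠ y,
  |G(K, M, m²)(x, y)| ≤ C·((L^K)∕r(x, y))^{d−1}` — in unit coordinates (`|x − y| = r·η`, `η = L^{−K}`) this is `C·|x − y|^{2−(d+1)}`, the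
  printed exponent `(L^jη)^{2−d}` of (3.63) at the scale `L^jη ≈ |x − y|`, uniformly in `K`, the volume and the mass;
  ★ **`fullProp_diag_le_unif`** (`2 ≤ d`): all pairs `≤ C·(L^K)^{d−1} = C·η^{−(d−1)}` — with part O-c's `fullProp_diag_ge` the diagonal is
  EXACTLY of this order (the `j = 0` exponent of (3.63)).
DOWNSTREAM SHAPE SERVED (by name, nothing instantiated): the pointwise sub-unit profile «`|∇_yG_k(x,y)| ≤ C|x − y|^{1−d}`, `1 ≤ |x − y| ≤ L^k`»
is the UNPRINTED wall input (W1) of the T⁴ cell's `T4TwoSpacingDefect.ConsistencySized` (clause (T2), node NE3 = N16); §2 is its KERNEL line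
for KING'S `A = 0` OBJECT (the gradient line is part R-c); NOTHING is asserted for Bałaban's `G_k(U)`.
WHAT THE CURVED CASE ADDS (one line): the same power law for `G_k(U)` uniformly over the live window `Reg335` ([B9] prints unit-cube-localised
OPERATOR bounds (3.42)–(3.47) and bounded unit-scale kernels (3.49), (3.133), not the sub-unit pointwise profile).
HONEST SCOPE.  (i) `A = 0`, periodic b.c., odd `L ≥ 3`, `0 < m² ≤ m₀²`, cubes `2L^e`; (ii) lattice units of the level-`K` lattice; (iii) `K ≥ 1`;
(iv) `d ≥ 2` (in `d + 1 = 2` dimensions the kernel is logarithmic in `K` on the diagonal and part R-a's level sum is the statement); (v) nothing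
here is Bałaban's `G_k(U)`; not a discharge.
Locators: [King1986] C. King, CMP **102** (1986) 649–677: (2.13)–(2.17) p. 653, (2.20) p. 654, Theorem 3.3 p. 655, (3.7) p. 656, Prop. 3.7 (3.63)
p. 663, (4.42)–(4.44) p. 675; [Ba 4] = [Balaban1983RegularityDecay] Theorem (1.10) p. 573.
-/

noncomputable section

namespace Summit.QuantumFields.YangMills.BalabanUVNodes.N15KingModelRung.Curved

open Real Finset Matrix
open Literature.MathematicalPhysics.QuantumFieldTheory.Balaban1983to89.B5Prop11Plancherel (Tor fine)
open Literature.MathematicalPhysics.QuantumFieldTheory.King1986 (aK aK_pos sliceSum_le)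
open Literature.MathematicalPhysics.QuantumFieldTheory.King1986.Torus (constrainedProp tdistT tdistT_nonneg)

variable {d : ℕ} (L : ℕ) [NeZero L]

/-! ## §1 The level sum IS King's slice sum: `Σ_{i<K}(L^p)^i e^{−δrL^i∕L^K} ≤ (K_p(δ∕L)∕L^p)·(L^K∕r)^p` -/

/-- One term of the level sum in the spelling of `King1986.sliceSum_le` (slice variable `j = K − 1 − i`, spacing `η = (L^K)⁻¹`, unit
coordinates `r∕L^K`, rate `δ∕L`): `(L^p)^{K−1−j}·e^{−δ·r·L^{K−1−j}∕L^K} = (L^p)⁻¹·e^{−(δ∕L)·((r∕L^K)∕(ηL^j))}∕(ηL^j)^p`. [folklore] -/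
theorem levelTerm_eq {Lr δ r : ℝ} (hL : 0 < Lr) (p K j : ℕ) (hj : j < K) :
    (Lr ^ p) ^ (K - 1 - j) * Real.exp (-(δ * (r * Lr ^ (K - 1 - j) / Lr ^ K)))
      = (Lr ^ p)⁻¹ * (Real.exp (-(δ / Lr * (r / Lr ^ K / ((Lr ^ K)⁻¹ * Lr ^ j)))) / ((Lr ^ K)⁻¹ * Lr ^ j) ^ p) := by
  have hK : Lr ^ K = Lr ^ (K - 1 - j) * Lr ^ j * Lr := by
    rw [← pow_add, ← pow_succ]
    congr 1
    omega
  have hA : 0 < Lr ^ (K - 1 - j) := pow_pos hL _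
  have hj0 : 0 < Lr ^ j := pow_pos hL _
  have hLp : 0 < Lr ^ p := pow_pos hL _
  -- the exponents agree
  have he : δ * (r * Lr ^ (K - 1 - j) / Lr ^ K) = δ / Lr * (r / Lr ^ K / ((Lr ^ K)⁻¹ * Lr ^ j)) := by
    rw [hK]
    field_simp
  -- the prefactors agree
  have hpre : (Lr ^ p) ^ (K - 1 - j) = (Lr ^ p)⁻¹ * (((Lr ^ K)⁻¹ * Lr ^ j) ^ p)⁻¹ := by
    have h1 : (Lr ^ K)⁻¹ * Lr ^ j = (Lr ^ (K - 1 - j) * Lr)⁻¹ := by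
      rw [hK]
      apply eq_inv_of_mul_eq_one_left
      field_simp
    rw [h1, inv_pow, inv_inv, mul_pow, ← pow_mul, mul_comm p (K - 1 - j), pow_mul]
    field_simp
  rw [he, hpre, div_eq_mul_inv]
  ring

/-- **The level sum is bounded by the power law** (`L ≥ 2`, `δ > 0`, `p ≥ 1`, fine distance `r ≥ 1`, any number of levels `K`):
`Σ_{i<K} (L^p)^i·e^{−δ·r·L^i∕L^K} ≤ (K_p(δ∕L)∕L^p)·(L^K∕r)^p`, `K_p(δ) = 2(p+1)!∕δ^{p+1} + 2` — `Finset.sum_range_reflect` + the tree's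
`King1986.sliceSum_le` (the bookkeeping «(3.63) per slice ⇒ power law») at `η = (L^K)⁻¹`. [cite: King1986, Prop. 3.7 (3.63) p.663] -/
theorem levelSum_le_powerLaw {Lr δ r : ℝ} (hL : 2 ≤ Lr) (hδ : 0 < δ) {p : ℕ} (hp : 1 ≤ p) (K : ℕ) (hr : 1 ≤ r) :
    ∑ i ∈ Finset.range K, (Lr ^ p) ^ i * Real.exp (-(δ * (r * Lr ^ i / Lr ^ K)))
      ≤ (2 * (p + 1).factorial / (δ / Lr) ^ (p + 1) + 2) / Lr ^ p * (Lr ^ K / r) ^ p := by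
  have hL0 : 0 < Lr := by linarith
  have hLK : 0 < Lr ^ K := pow_pos hL0 K
  have hLp : 0 < Lr ^ p := pow_pos hL0 p
  have hr0 : 0 < r := by linarith
  have hη : (0 : ℝ) < (Lr ^ K)⁻¹ := inv_pos.mpr hLK
  have hηr : (Lr ^ K)⁻¹ ≤ r / Lr ^ K := by
    rw [inv_eq_one_div]
    exact div_le_div_of_nonneg_right hr hLK.le
  have hS := sliceSum_le Lr ((Lr ^ K)⁻¹) (δ / Lr) (r / Lr ^ K) p K hL hη (div_pos hδ hL0) hηr hp
  -- reflect the level index and identify termwise with the slice sum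
  rw [← Finset.sum_range_reflect]
  have hterm : ∀ j ∈ Finset.range K,
      (Lr ^ p) ^ (K - 1 - j) * Real.exp (-(δ * (r * Lr ^ (K - 1 - j) / Lr ^ K)))
        = (Lr ^ p)⁻¹ * (Real.exp (-(δ / Lr * (r / Lr ^ K / ((Lr ^ K)⁻¹ * Lr ^ j)))) / ((Lr ^ K)⁻¹ * Lr ^ j) ^ p) :=
    fun j hj => levelTerm_eq hL0 p K j (Finset.mem_range.mp hj)
  rw [Finset.sum_congr rfl hterm, ← Finset.mul_sum]
  have hpow : (r / Lr ^ K) ^ p = ((Lr ^ K / r) ^ p)⁻¹ := by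
    rw [← inv_pow, inv_div]
  calc (Lr ^ p)⁻¹ * ∑ j ∈ Finset.range K,
          Real.exp (-(δ / Lr * (r / Lr ^ K / ((Lr ^ K)⁻¹ * Lr ^ j)))) / ((Lr ^ K)⁻¹ * Lr ^ j) ^ p
      ≤ (Lr ^ p)⁻¹ * ((2 * (p + 1).factorial / (δ / Lr) ^ (p + 1) + 2) / (r / Lr ^ K) ^ p) :=
        mul_le_mul_of_nonneg_left hS (inv_nonneg.mpr hLp.le)
    _ = (2 * (p + 1).factorial / (δ / Lr) ^ (p + 1) + 2) / Lr ^ p * (Lr ^ K / r) ^ p := by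
        rw [hpow, div_eq_mul_inv, inv_inv, div_eq_mul_inv]
        ring

/-- **The level sum is at most geometric**: for `Λ ≥ 2` and weights `w_i ≤ 1`, `Σ_{i<K} Λ^i·w_i ≤ Λ^K` (`geom_sum_eq`). [folklore] -/
theorem levelSum_le_geom {Λ : ℝ} (hΛ : 2 ≤ Λ) (K : ℕ) (w : ℕ → ℝ) (hw1 : ∀ i, w i ≤ 1) :
    ∑ i ∈ Finset.range K, Λ ^ i * w i ≤ Λ ^ K := by
  have hΛ0 : 0 ≤ Λ := by linarith
  have hΛ1 : Λ ≠ 1 := by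
    intro h
    linarith
  calc ∑ i ∈ Finset.range K, Λ ^ i * w i ≤ ∑ i ∈ Finset.range K, Λ ^ i := by
        refine Finset.sum_le_sum fun i _ => ?_
        calc Λ ^ i * w i ≤ Λ ^ i * 1 := mul_le_mul_of_nonneg_left (hw1 i) (pow_nonneg hΛ0 i)
          _ = Λ ^ i := mul_one _
    _ = (Λ ^ K - 1) / (Λ - 1) := geom_sum_eq hΛ1 K
    _ ≤ Λ ^ K := by
        rw [div_le_iff₀ (by linarith)]
        nlinarith [one_le_pow₀ (show (1 : ℝ) ≤ Λ by linarith) (n := K)]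

/-! ## §2 The power law `|G^η_K(x, y)| ≤ C·(L^K∕r)^{d−1}` for `x ≠ y`, and the diagonal order `(L^K)^{d−1}` -/

omit [NeZero L] in
/-- `Λ = L^{d+1}∕L² = L^{d−1}` for `d ≥ 1`. [cite: King1986, (2.20) p.654] -/
theorem Lam_eq_pow (hL : 2 ≤ L) (hd : 1 ≤ d) : (L : ℝ) ^ (d + 1) / (L : ℝ) ^ 2 = (L : ℝ) ^ (d - 1) := by
  have hL0 : (L : ℝ) ≠ 0 := by exact_mod_cast (show L ≠ 0 by omega)
  rw [div_eq_iff (pow_ne_zero 2 hL0), ← pow_add]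
  congr 1
  omega

/-- **THE POWER LAW: KING'S (3.63) SUMMED, FOR THE FULL `A = 0` PROPAGATOR** (`d ≥ 2`, i.e. King's `d + 1 ≥ 3`): for odd `L ≥ 3`, `a > 0`,
`m₀² ≥ 0` there is `C > 0` (a function of `d, L, a, m₀²`) such that for EVERY `K ≥ 1` (any spelling `N = L^K`), cube `M_μ = 2L^e`, mass
`0 < m² ≤ m₀²` and all DISTINCT fine points `x ≠ y` (fine torus distance `r = |x − y|_{fine N M} ≥ 1`):
`|G^η_K(x, y)| ≤ C·(L^K∕r)^{d−1}` — in unit coordinates (`|x − y| = r·L^{−K}`) the Theorem 3.3 ∕ [Ba 4]-type kernel singularity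
`C·|x − y|^{2−(d+1)}` (the printed exponent `(L^jη)^{2−d}` of (3.63) at the scale `L^jη ≈ |x − y|`), UNIFORM in `K`, the volume and the
mass (part R-a `fullProp_profile_unif` + §1 `levelSum_le_powerLaw` + R-a `one_le_tdistT_of_ne`).  The (2.17)-summed SHAPE of Prop. 3.7 for King's (2.13) at `A = 0`, NOT a
printed proposition; nothing here is Bałaban's `G_k(U)`. [cite: King1986, (2.13)–(2.17) p.653, Theorem 3.3 p.655, (3.7) p.656, Prop. 3.7 (3.63) p.663; Balaban1983RegularityDecay, Theorem (1.10) p.573] -/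
theorem fullProp_powerLaw_unif (hd : 2 ≤ d) (hLodd : Odd L) (hL : 2 ≤ L) {a : ℝ} (ha : 0 < a) {m0sq : ℝ} (hm0 : 0 ≤ m0sq) :
    ∃ C : ℝ, 0 < C ∧ ∀ (K : ℕ), 1 ≤ K → ∀ (N : ℕ) [NeZero N], N = L ^ K →
      ∀ (e : ℕ) (M : Fin (d + 1) → ℕ) [∀ μ, NeZero (M μ)], (∀ μ, M μ = 2 * L ^ e) →
      ∀ (msq : ℝ), 0 < msq → msq ≤ m0sq → ∀ x y : Tor (fine N M), x ≠ y →
        |constrainedProp N M (aK a L K) (((N : ℕ) : ℝ) ^ 2) msq x y|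
          ≤ C * (((L : ℝ) ^ K) / tdistT (fine N M) x y) ^ (d - 1) := by
  have hLr : (2 : ℝ) ≤ L := by exact_mod_cast hL
  have hL0 : (0 : ℝ) < L := by linarith
  obtain ⟨C₀, δ, hC₀, hδ, H⟩ := fullProp_profile_unif (d := d) L hLodd hL ha hm0
  have hp : 1 ≤ d - 1 := by omega
  set Kp : ℝ := (2 * ((d - 1) + 1).factorial / (δ / L) ^ ((d - 1) + 1) + 2) / (L : ℝ) ^ (d - 1) with hKp
  have hKp0 : 0 < Kp := by positivity
  refine ⟨C₀ * Kp, mul_pos hC₀ hKp0, ?_⟩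
  intro K hK N _ hN e M _ hM msq hmsq hcap x y hxy
  have h := H K hK N hN e M hM msq hmsq hcap x y
  set r : ℝ := tdistT (fine N M) x y with hrdef
  have hr : 1 ≤ r := one_le_tdistT_of_ne (fine N M) hxy
  have hNc : (N : ℝ) = (L : ℝ) ^ K := by rw [hN]; push_cast; ring
  -- rewrite the level sum only (the cast `↑N` also sits inside `G`'s arguments)
  have hs : ∑ i ∈ Finset.range K, ((L : ℝ) ^ (d + 1) / (L : ℝ) ^ 2) ^ i * Real.exp (-(δ * (r * (L : ℝ) ^ i / (N : ℝ))))
      = ∑ i ∈ Finset.range K, ((L : ℝ) ^ (d - 1)) ^ i * Real.exp (-(δ * (r * (L : ℝ) ^ i / (L : ℝ) ^ K))) :=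
    Finset.sum_congr rfl fun i _ => by rw [Lam_eq_pow L hL (by omega), hNc]
  rw [hs] at h
  have hsum := levelSum_le_powerLaw hLr hδ hp K hr
  calc |constrainedProp N M (aK a L K) (((N : ℕ) : ℝ) ^ 2) msq x y|
      ≤ C₀ * ∑ i ∈ Finset.range K, ((L : ℝ) ^ (d - 1)) ^ i * Real.exp (-(δ * (r * (L : ℝ) ^ i / (L : ℝ) ^ K))) := h
    _ ≤ C₀ * (Kp * (((L : ℝ) ^ K) / r) ^ (d - 1)) := mul_le_mul_of_nonneg_left hsum hC₀.le
    _ = C₀ * Kp * (((L : ℝ) ^ K) / r) ^ (d - 1) := by ring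

/-- **THE DIAGONAL ORDER** (`d ≥ 2`): `∃ C > 0 ∀ K ≥ 1 … ∀ x y, |G^η_K(x, y)| ≤ C·(L^K)^{d−1}` — all pairs, the diagonal included; with part O-c's
`fullProp_diag_ge` (`G^η_K(x, x) ≥ c·Λ^{K−1}`) the diagonal is EXACTLY of order `(L^K)^{d−1} = η^{−(d−1)}`, the `j = 0` exponent
`(L^jη)^{2−d}` of (3.63) at `L^jη = η` (part R-a `fullProp_profile_unif` + `levelSum_le_geom`). [cite: King1986, Prop. 3.7 (3.63) p.663, (2.20) p.654] -/
theorem fullProp_diag_le_unif (hd : 2 ≤ d) (hLodd : Odd L) (hL : 2 ≤ L) {a : ℝ} (ha : 0 < a) {m0sq : ℝ} (hm0 : 0 ≤ m0sq) :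
    ∃ C : ℝ, 0 < C ∧ ∀ (K : ℕ), 1 ≤ K → ∀ (N : ℕ) [NeZero N], N = L ^ K →
      ∀ (e : ℕ) (M : Fin (d + 1) → ℕ) [∀ μ, NeZero (M μ)], (∀ μ, M μ = 2 * L ^ e) →
      ∀ (msq : ℝ), 0 < msq → msq ≤ m0sq → ∀ x y : Tor (fine N M),
        |constrainedProp N M (aK a L K) (((N : ℕ) : ℝ) ^ 2) msq x y| ≤ C * (((L : ℝ) ^ K)) ^ (d - 1) := by
  have hLr : (2 : ℝ) ≤ L := by exact_mod_cast hL
  have hL0 : (0 : ℝ) < L := by linarith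
  obtain ⟨C₀, δ, hC₀, hδ, H⟩ := fullProp_profile_unif (d := d) L hLodd hL ha hm0
  refine ⟨C₀, hC₀, ?_⟩
  intro K hK N _ hN e M _ hM msq hmsq hcap x y
  have h := H K hK N hN e M hM msq hmsq hcap x y
  rw [Lam_eq_pow L hL (by omega)] at h
  have hΛ2 : (2 : ℝ) ≤ (L : ℝ) ^ (d - 1) := by
    calc (2 : ℝ) ≤ L := hLr
      _ = (L : ℝ) ^ 1 := (pow_one _).symm
      _ ≤ (L : ℝ) ^ (d - 1) := pow_le_pow_right₀ (by linarith) (by omega)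
  have hgeom := levelSum_le_geom hΛ2 K (fun i => Real.exp (-(δ * (tdistT (fine N M) x y * (L : ℝ) ^ i / (N : ℝ)))))
    (fun i => Real.exp_le_one_iff.mpr (by
      have := tdistT_nonneg (fine N M) x y
      have : 0 ≤ δ * (tdistT (fine N M) x y * (L : ℝ) ^ i / (N : ℝ)) := by positivity
      linarith))
  calc |constrainedProp N M (aK a L K) (((N : ℕ) : ℝ) ^ 2) msq x y|
      ≤ C₀ * ∑ i ∈ Finset.range K, ((L : ℝ) ^ (d - 1)) ^ i
          * Real.exp (-(δ * (tdistT (fine N M) x y * (L : ℝ) ^ i / (N : ℝ)))) := h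
    _ ≤ C₀ * ((L : ℝ) ^ (d - 1)) ^ K := mul_le_mul_of_nonneg_left hgeom hC₀.le
    _ = C₀ * ((L : ℝ) ^ K) ^ (d - 1) := by rw [← pow_mul, ← pow_mul, Nat.mul_comm]

end Summit.QuantumFields.YangMills.BalabanUVNodes.N15KingModelRung.Curved
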